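import Summits.HodgeConjecture.CorCM.Model.WeilFaceAlgebraicOfWeilLineClasses
import Summits.HodgeConjecture.CorCM.Model.CMProdBiproduct
import Summits.HodgeConjecture.CorCM.Model.CMAbelianVarietyRealisedHolds
import Literature.AlgebraicGeometry.HodgeTheory.AbelianVarietyHodgeFullnessHolds
import Literature.AlgebraicGeometry.HodgeTheory.ComplexConjugationHolds
import Literature.AlgebraicGeometry.HodgeTheory.HodgeFiltrationModelsReductionProofs
import Literature.AlgebraicGeometry.Motives.SupersingularAbelianVariety
import HarnessLib

/-!
# COR-CM (cell `pub-hodgecm2`): the `F`-generated CM slice of the Hodge conjecture from the algebraicity of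
# the face lines of `F` — explicit carriers (finite products of realisations of CM types of CM fields
# embeddable in `F`, e.g. `B^{a+1} × E^{b+1}`, and everything they dominate)

HONEST FRAMING.  A count-neutral JUNCTION on real carriers (no new case of the Hodge conjecture is proved
here unconditionally; no definition, no named fact; seat b24 gen 10, no BINDER-OWNERS row).  It makes
explicit the «transfer to tree abelian varieties `B^a × E^b` by domination» of
`HOME/pub-hodgecm2-lit-andre-3/A1-BLUEPRINT.md` (T4 (ii)) and PORTFOLIO-lit-andre-3 §3.1 CONSEQUENCE 2, for an
ARBITRARY Galois CM field `F` with `6 ≤ [F:ℚ]`: if the Weil LINES of all rank-four faces of `F` are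
algebraic (on the model universe of record, or — equivalently fed — the rational `(2,2)` `K`-Weil-line
classes of the four corner realisations of every face), then the Hodge conjecture holds, in every
codimension, for every complex abelian variety dominated by (in particular isogenous to) a finite product
of abelian varieties each realising, on `H¹`, a CM type of a CM field `E` admitting an embedding
`E →+* F` — e.g. `B^{a+1} × E^{b+1}` for a realisation `B` of a CM type of `F` and a CM elliptic curve /
CM abelian variety `E` of a CM subfield of `F`.

The two inputs are tree theorems: seat b07's rung `Model.hc_cmProd_of_weilFaceAlgebraic_of_riemann` (faces of
`F` algebraic ⟹ `U.HC (U.cmProd F Θ)` for every family `Θ` of CM types of `F`: Pohlmann's span theorem +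
[QW8] Thm 2.5, modulo Riemann's theorem) and the DOMINATION calculus of rows M14/M20
(`Domination.AVDominatedBy`, `Domination.cmProdAV F h₃ n Θ = ∏_j A_{(F,Θ_j)}`, Shimura's type inflation
`Domination.avDominatedBy_of_inducedCMType`).  What is added (§1) is the EXPLICIT-LEAF form of
`Domination.isProductOf_isCMTyped_avDominatedBy` / `coded_avDominatedBy`: no opaque code `v`, no
`LeafEmbeddable` — the leaves are realisation triples `IsCMTypeRealisation Φ B ι θ` of CM types `Φ` of CM
fields `E` GIVEN with an embedding `k : E →+* F`:

* `exists_avDominatedBy_cmProdAV_prod_cmProdAV`, `exists_avDominatedBy_cmProdAV_prod` — «dominated by some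
  `cmProdAV F h₃ n Θ`» is closed under binary products (re-association, `Domination.prodAssoc`);
* `avDominatedBy_cmAV_of_isCMTypeRealisation_of_embedding` — a realisation of `(E; Φ)` with `k : E →+* F` is
  dominated by the chosen realisation `A_{(F, Φ^F)}` of the induced type (Shimura §6.2 Thm. 3 + §6.1 Cor.,
  `avDominatedBy_of_inducedCMType` with `isCMTypeRealisation_cmCode`);
* `exists_avDominatedBy_cmProdAV_of_isProductOf_realisations` — product trees (`AbelianVariety.IsProductOf`) of
  such realisations are dominated by some `cmProdAV F h₃ n Θ`; `isProductOf_powSucc`,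
  `isProductOf_powSucc_prod_powSucc` — `B^{a+1} × E^{b+1}` is such a product tree;
* `hodgeConjectureFor_of_avDominatedBy` — `HodgeConjectureFor` descends along a domination
  (`AndreSplit.mem_algebraicClasses_of_avDominatedBy`, Mumford §19).

§2 then reads b07's rung on these carriers, in BOTH hypothesis shapes — the universe shape
`hfaces : ∀ f, U.WeilFaceAlgebraic F f` (the output shape of a face-by-face proof such as the cyclic-sextic
line over Markman's fourfold theorem, seats b30/b24/p2/b07) and André's `hW` shape of
`Model.hodgeConjectureFor_of_avDominatedBy_cmProdAV_of_weilLineClasses_of_riemann` — and §3 instantiates the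
model data by the tree theorems `exists_isReal_hodgeModel_holds`, `hodgePQ_independent_of_hodgeModel_holds`,
`cmAbelianVarietyRealised_holds`, `deligneMilne1982_Thm_6_20_full_holds` and the kernel packaging
`ballQuotientUniformisedDatum_of h₁`: displayed leaves `{h₁, faces of F}`.

References: G. Shimura, *Abelian Varieties with Complex Multiplication and Modular Functions* (1998), §6.1
Cor. of Thm. 2 (p. 41), §6.2 Thm. 3 (pp. 41–43); D. Mumford, *Abelian Varieties* (1970), §19 Thm. 1 and
p. 169; Y. André, Progr. Math. 102 (1992) pp. 1–7; J. S. Milne, *Hodge classes on abelian varieties* (2020)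
Thm. 1; H. Pohlmann, Ann. of Math. 88 (1968) Thm. 1; P. Deligne, J. S. Milne, LNM 900 (1982) Thm. 6.20.
-/

noncomputable section

open CategoryTheory NumberField
open Literature.AlgebraicGeometry Literature.AlgebraicGeometry.Motives Literature.AlgebraicGeometry.HodgeTheory
open Literature.AlgebraicGeometry.ComplexMultiplication Literature.AlgebraicGeometry.Milne1999
open Literature.NumberTheory.ComplexMultiplication (inducedCMType inducedCMType_id)
open Literature.NumberTheory.Automorphic
open Literature.NumberTheory.Automorphic.PicardCM (CMCode cmRealisation CMAbelianVarietyRealised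
  BallQuotientUniformisedDatum BallQuotientUniformised ballQuotientUniformisedDatum_of)

/-! ## §1 Explicit-leaf domination by `∏_j A_{(F,Θ_j)}` -/

namespace Summit.HodgeConjecture.CorCM.Domination

variable {F : Type} [Field F] [NumberField F] [IsCMField F]

/-- **Re-association**: `cmProdAV F h₃ m Θ' × cmProdAV F h₃ n Θ` is dominated by (indeed isomorphic to) ONE
left-nested product `cmProdAV F h₃ N Θ''` (`N = m + n + 1`, `Θ''` the concatenated family) — induction on `n`
with `cmProdAV_snoc` and the associator `prodAssoc`. [cite: MumfordAV1970, §19] -/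
theorem exists_avDominatedBy_cmProdAV_prod_cmProdAV (h₃ : CMAbelianVarietyRealised) (m : ℕ)
    (Θ' : Fin (m + 1) → CMType F) :
    ∀ (n : ℕ) (Θ : Fin (n + 1) → CMType F), ∃ (N : ℕ) (Θ'' : Fin (N + 1) → CMType F),
      AVDominatedBy ((cmProdAV F h₃ m Θ').prod (cmProdAV F h₃ n Θ)) (cmProdAV F h₃ N Θ'')
  | 0, Θ => ⟨m + 1, Fin.snoc Θ' (Θ 0), by
      rw [cmProdAV_snoc, cmProdAV_zero]
      exact AVDominatedBy.refl _⟩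
  | n + 1, Θ => by
      obtain ⟨N, Θ'', h⟩ :=
        exists_avDominatedBy_cmProdAV_prod_cmProdAV h₃ m Θ' n (fun i => Θ i.castSucc)
      refine ⟨N + 1, Fin.snoc Θ'' (Θ (Fin.last (n + 1))), ?_⟩
      rw [cmProdAV_succ F h₃ n Θ, cmProdAV_snoc F h₃ N Θ'' (Θ (Fin.last (n + 1)))]
      exact AVDominatedBy.of_iso (prodAssoc _ _ _) (h.prod (AVDominatedBy.refl _))

/-- **«Dominated by some `∏_j A_{(F,Θ_j)}`» is closed under binary products** (`AVDominatedBy.prod` and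
re-association). [cite: MumfordAV1970, §19] -/
theorem exists_avDominatedBy_cmProdAV_prod (h₃ : CMAbelianVarietyRealised) {A B : AbelianVariety ℂ}
    (hA : ∃ (m : ℕ) (Θ' : Fin (m + 1) → CMType F), AVDominatedBy A (cmProdAV F h₃ m Θ'))
    (hB : ∃ (n : ℕ) (Θ : Fin (n + 1) → CMType F), AVDominatedBy B (cmProdAV F h₃ n Θ)) :
    ∃ (N : ℕ) (Θ'' : Fin (N + 1) → CMType F), AVDominatedBy (A.prod B) (cmProdAV F h₃ N Θ'') := by
  obtain ⟨m, Θ', hA⟩ := hA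
  obtain ⟨n, Θ, hB⟩ := hB
  obtain ⟨N, Θ'', h⟩ := exists_avDominatedBy_cmProdAV_prod_cmProdAV h₃ m Θ' n Θ
  exact ⟨N, Θ'', (hA.prod hB).trans h⟩

/-- **Product trees**: a finite product (`AbelianVariety.IsProductOf`) of abelian varieties each dominated by
some `∏_j A_{(F,Θ_j)}` is dominated by some `∏_j A_{(F,Θ_j)}`. [cite: MumfordAV1970, §19] -/
theorem exists_avDominatedBy_cmProdAV_of_isProductOf (h₃ : CMAbelianVarietyRealised) {P : AbelianVariety ℂ}
    (hP : AbelianVariety.IsProductOf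
      (fun B => ∃ (n : ℕ) (Θ : Fin (n + 1) → CMType F), AVDominatedBy B (cmProdAV F h₃ n Θ)) P) :
    ∃ (n : ℕ) (Θ : Fin (n + 1) → CMType F), AVDominatedBy P (cmProdAV F h₃ n Θ) := by
  induction hP with
  | atom h => exact h
  | prod _ _ ih₁ ih₂ => exact exists_avDominatedBy_cmProdAV_prod h₃ ih₁ ih₂

/-- **The leaf (Shimura's type inflation, explicit form)**: if `(B, ι, θ)` realises on `H¹` a CM type `Φ` of a
CM field `E` and `k : E →+* F`, then `B` is dominated by the chosen realisation `A_{(F, Φ^F)}` of the induced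
type `inducedCMType k Φ` (read over `F`, `isCMTypeRealisation_cmCode`): Theorem 3's isogenous power and the
Corollary of Theorem 2, `avDominatedBy_of_inducedCMType`.
[cite: Shimura1998, §6.2 Theorem 3 and §6.1 Corollary of Theorem 2 (pp. 41–43)] -/
theorem avDominatedBy_cmAV_of_isCMTypeRealisation_of_embedding (h₃ : CMAbelianVarietyRealised)
    (hd : Shimura1998_Thm3_isogenousPower)
    (hcor : Shimura1998_Thm2_Cor) {E : Type} [Field E] [NumberField E] [IsCMField E] (k : E →+* F)
    {Φ : CMType E} {B : AbelianVariety ℂ} {ι : 𝓞 E →+* End B}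
    {θ : E →+* Module.End ℂ (complexBetti B.X 1)} (hB : IsCMTypeRealisation Φ B ι θ) :
    AVDominatedBy B (cmRealisation h₃ (cmCode F (inducedCMType k Φ))).AV :=
  avDominatedBy_of_inducedCMType hd hcor k Φ hB (isCMTypeRealisation_cmCode F h₃ (inducedCMType k Φ))

/-- The leaf in `cmProdAV` form: a realisation of `(E; Φ)` with `k : E →+* F` is dominated by
`cmProdAV F h₃ 0 (fun _ => Φ^F) = A_{(F, Φ^F)}`.
[cite: Shimura1998, §6.2 Theorem 3 and §6.1 Corollary of Theorem 2 (pp. 41–43)] -/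
theorem exists_avDominatedBy_cmProdAV_of_isCMTypeRealisation_of_embedding
    (h₃ : CMAbelianVarietyRealised) (hd : Shimura1998_Thm3_isogenousPower) (hcor : Shimura1998_Thm2_Cor)
    {E : Type} [Field E] [NumberField E] [IsCMField E] (k : E →+* F)
    {Φ : CMType E} {B : AbelianVariety ℂ} {ι : 𝓞 E →+* End B}
    {θ : E →+* Module.End ℂ (complexBetti B.X 1)} (hB : IsCMTypeRealisation Φ B ι θ) :
    ∃ (n : ℕ) (Θ : Fin (n + 1) → CMType F), AVDominatedBy B (cmProdAV F h₃ n Θ) :=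
  ⟨0, fun _ => inducedCMType k Φ, by
    rw [cmProdAV_zero]
    exact avDominatedBy_cmAV_of_isCMTypeRealisation_of_embedding h₃ hd hcor k hB⟩

/-- The leaf over `F` itself (`k = id`, `inducedCMType_id`): a realisation of `(F; Φ)` is dominated by the
CHOSEN realisation `A_{(F,Φ)} = cmProdAV F h₃ 0 (fun _ => Φ)` (Shimura §6.1 Corollary: two realisations of one
type are isogenous). [cite: Shimura1998, §6.1 Corollary of Theorem 2 (p. 41)] -/
theorem avDominatedBy_cmProdAV_zero_of_isCMTypeRealisation (h₃ : CMAbelianVarietyRealised)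
    (hd : Shimura1998_Thm3_isogenousPower)
    (hcor : Shimura1998_Thm2_Cor) {Φ : CMType F} {B : AbelianVariety ℂ} {ι : 𝓞 F →+* End B}
    {θ : F →+* Module.End ℂ (complexBetti B.X 1)} (hB : IsCMTypeRealisation Φ B ι θ) :
    AVDominatedBy B (cmProdAV F h₃ 0 (fun _ => Φ)) := by
  have h := avDominatedBy_cmAV_of_isCMTypeRealisation_of_embedding h₃ hd hcor (RingHom.id F) hB
  rw [inducedCMType_id] at h
  rw [cmProdAV_zero]
  exact h

/-- **Explicit-leaf domination.**  Let `P` be a finite product (`AbelianVariety.IsProductOf`) of complex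
abelian varieties `B`, each carrying a realisation `(B, ι, θ)` on `H¹` of some CM type `Φ` of some CM field `E`
admitting an embedding `E →+* F`.  Then `P` is dominated by `∏_j A_{(F,Θ_j)} = cmProdAV F h₃ n Θ` for some
finite family `Θ` of CM types of `F` (the induced types of the leaves, concatenated).  Explicit-leaf form of
`isProductOf_isCMTyped_avDominatedBy` / `coded_avDominatedBy`.
[cite: Shimura1998, §6.2 Theorem 3 and §6.1 Corollary of Theorem 2 (pp. 41–43)] [cite: MumfordAV1970, §19] -/
theorem exists_avDominatedBy_cmProdAV_of_isProductOf_realisations (h₃ : CMAbelianVarietyRealised)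
    (hd : Shimura1998_Thm3_isogenousPower)
    (hcor : Shimura1998_Thm2_Cor) {P : AbelianVariety ℂ}
    (hP : AbelianVariety.IsProductOf (fun B : AbelianVariety ℂ =>
      ∃ (E : Type) (_ : Field E) (_ : NumberField E) (_ : IsCMField E) (_ : E →+* F) (Φ : CMType E)
        (ι : 𝓞 E →+* End B) (θ : E →+* Module.End ℂ (complexBetti B.X 1)),
        IsCMTypeRealisation Φ B ι θ) P) :
    ∃ (n : ℕ) (Θ : Fin (n + 1) → CMType F), AVDominatedBy P (cmProdAV F h₃ n Θ) :=
  exists_avDominatedBy_cmProdAV_of_isProductOf h₃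
    (hP.mono fun _ ⟨_, _, _, _, k, _, _, _, hB⟩ =>
      exists_avDominatedBy_cmProdAV_of_isCMTypeRealisation_of_embedding h₃ hd hcor k hB)

/-- Powers are product trees: `Q A → IsProductOf Q (A^{n+1})` (`AbelianVariety.powSucc`). [folklore] -/
theorem isProductOf_powSucc {Q : AbelianVariety ℂ → Prop} {A : AbelianVariety ℂ} (hA : Q A) :
    ∀ n : ℕ, AbelianVariety.IsProductOf Q (A.powSucc n)
  | 0 => .atom hA
  | n + 1 => .prod (isProductOf_powSucc hA n) (.atom hA)

/-- `B^{a+1} × E^{b+1}` is a product tree of `B`'s and `E`'s. [folklore] -/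
theorem isProductOf_powSucc_prod_powSucc {Q : AbelianVariety ℂ → Prop} {B E : AbelianVariety ℂ}
    (hB : Q B) (hE : Q E) (a b : ℕ) :
    AbelianVariety.IsProductOf Q ((B.powSucc a).prod (E.powSucc b)) :=
  .prod (isProductOf_powSucc hB a) (isProductOf_powSucc hE b)

/-- **`HodgeConjectureFor` descends along a domination** `s ≫ π = [N]_A`, `N ≠ 0` (Hodge classes of `A` pull
back from `P` up to `N^{2p}`: `AndreSplit.mem_algebraicClasses_of_avDominatedBy`; the Hodge-model conjunct by
`nonempty_hodgeModel_holds`). [cite: MumfordAV1970, §19 Thm. 1 and p. 169] -/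
theorem hodgeConjectureFor_of_avDominatedBy {A P : AbelianVariety ℂ}
    (hP : HodgeConjectureFor P.dim P.X) (h : AVDominatedBy A P) : HodgeConjectureFor A.dim A.X :=
  ⟨nonempty_hodgeModel_holds (AbelianVariety.isSmoothProjective_holds (A := A)), fun p c hc hpp =>
    AndreSplit.mem_algebraicClasses_of_avDominatedBy h (fun c' hc' hh' => hP.2 p c' hc' hh') c hc hpp⟩

end Summit.HodgeConjecture.CorCM.Domination

/-! ## §2 The rung read on explicit carriers, modulo Riemann's theorem and the model data -/

namespace Summit.HodgeConjecture.CorCM.Model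

open Summit.HodgeConjecture.CorCM.Domination

/-- **`HodgeConjectureFor (∏_j A_{(F,Θ_j)})` from the algebraicity of all face lines of `F`** (Galois,
`6 ≤ [F:ℚ]`), universe shape `hfaces : ∀ f, U.WeilFaceAlgebraic F f`: b07's
`hc_cmProd_of_weilFaceAlgebraic_of_riemann` read on the tree's abelian variety `Domination.cmProdAV F h₃ n Θ`
(its underlying scheme is the interpretation of `U.cmProd F Θ`, `scheme_cmProd_universeOf`; dimensions by
`schemeDim_eq_holds`; `universeOf_hc_iff_hodgeConjectureFor`).  Modulo `hR` and the model data `hHD hI hU h₃`.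
[cite: Pohlmann1968, Thm. 1] [cite: Milne2020HodgeClassesAV, Theorem 1] -/
theorem hodgeConjectureFor_cmProdAV_of_weilFaceAlgebraic_of_riemann
    (hHD : exists_isReal_hodgeModel) (hI : hodgePQ_independent_of_hodgeModel)
    (hU : BallQuotientUniformisedDatum) (h₃ : CMAbelianVarietyRealised) (K : CMField)
    (hR : DeligneMilne1982_Thm_6_20_full) (hG : IsGalois ℚ K) (h6 : 6 ≤ Module.finrank ℚ K)
    (hfaces : ∀ f : Face K, (universeOf hHD hI hU h₃).WeilFaceAlgebraic K f)
    {n : ℕ} (Θ : Fin (n + 1) → CMType K) :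
    HodgeConjectureFor (Domination.cmProdAV K h₃ n Θ).dim (Domination.cmProdAV K h₃ n Θ).X := by
  have hX : PicardCM.Var.scheme hU h₃ ((universeOf hHD hI hU h₃).cmProd K Θ) =
      (Domination.cmProdAV K h₃ n Θ).X :=
    scheme_cmProd_universeOf hHD hI hU h₃ K n Θ
  have hdim : (Domination.cmProdAV K h₃ n Θ).dim =
      (universeOf hHD hI hU h₃).dim ((universeOf hHD hI hU h₃).cmProd K Θ) := by
    rw [AbelianVariety.dim, ← hX]
    exact schemeDim_eq_holds (PicardCM.Var.isSmoothProjective hU h₃ _)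
  rw [hdim, ← hX]
  exact (universeOf_hc_iff_hodgeConjectureFor hHD hI hU h₃ _).1
    (hc_cmProd_of_weilFaceAlgebraic_of_riemann hHD hI hU h₃ K hR hG h6 hfaces Θ)

/-- **… and for every abelian variety dominated by such a product** (universe shape).
[cite: MumfordAV1970, §19 Thm. 1 and p. 169] [cite: Milne2020HodgeClassesAV, Theorem 1] -/
theorem hodgeConjectureFor_of_avDominatedBy_cmProdAV_of_weilFaceAlgebraic_of_riemann
    (hHD : exists_isReal_hodgeModel) (hI : hodgePQ_independent_of_hodgeModel)
    (hU : BallQuotientUniformisedDatum) (h₃ : CMAbelianVarietyRealised) (K : CMField)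
    (hR : DeligneMilne1982_Thm_6_20_full) (hG : IsGalois ℚ K) (h6 : 6 ≤ Module.finrank ℚ K)
    (hfaces : ∀ f : Face K, (universeOf hHD hI hU h₃).WeilFaceAlgebraic K f)
    (A : AbelianVariety ℂ) {n : ℕ} {Θ : Fin (n + 1) → CMType K}
    (hdom : AVDominatedBy A (Domination.cmProdAV K h₃ n Θ)) : HodgeConjectureFor A.dim A.X :=
  hodgeConjectureFor_of_avDominatedBy
    (hodgeConjectureFor_cmProdAV_of_weilFaceAlgebraic_of_riemann hHD hI hU h₃ K hR hG h6 hfaces Θ) hdom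

/-- **The `F`-generated CM slice of the Hodge conjecture from the face lines of `F` (universe shape).**  Let `F`
be a Galois CM field with `6 ≤ [F:ℚ]` all of whose rank-four face lines are algebraic on the model universe
`U = Model.universeOf hHD hI hU h₃` (`hfaces`).  Let `P` be a finite product (`AbelianVariety.IsProductOf`) of
complex abelian varieties `B` each carrying a realisation `(B, ι, θ)` on `H¹` of some CM type of some CM field
`E` with an embedding `E →+* F` (realisations of types of `F` itself; CM elliptic curves of imaginary quadratic
subfields of `F`; …, with any multiplicities).  Then every complex abelian variety `A` dominated by `P`
(`AVDominatedBy A P`: `s ≫ π = [N]_A`, `N ≠ 0` — e.g. `A` isogenous to `P`, or an isogeny factor of `P`)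
satisfies `HodgeConjectureFor A.dim A.X`, in every codimension — modulo Riemann's theorem `hR` and the model
data.  Proof: `P` is dominated by some `∏_j A_{(F,Θ_j)}` (§1, Shimura's inflation via
`thm3_isogenousPower_of_riemann hR h₃` and `thm2_cor_of_riemann hR`), where b07's rung holds.
[cite: Shimura1998, §6.2 Theorem 3 and §6.1 Corollary of Theorem 2 (pp. 41–43)] [cite: MumfordAV1970, §19]
[cite: Pohlmann1968, Thm. 1] [cite: Milne2020HodgeClassesAV, Theorem 1] -/
theorem hodgeConjectureFor_of_avDominatedBy_isProductOf_of_weilFaceAlgebraic_of_riemann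
    (hHD : exists_isReal_hodgeModel) (hI : hodgePQ_independent_of_hodgeModel)
    (hU : BallQuotientUniformisedDatum) (h₃ : CMAbelianVarietyRealised) (K : CMField)
    (hR : DeligneMilne1982_Thm_6_20_full) (hG : IsGalois ℚ K) (h6 : 6 ≤ Module.finrank ℚ K)
    (hfaces : ∀ f : Face K, (universeOf hHD hI hU h₃).WeilFaceAlgebraic K f)
    {P A : AbelianVariety ℂ} (hP : AbelianVariety.IsProductOf (fun B : AbelianVariety ℂ =>
      ∃ (E : Type) (_ : Field E) (_ : NumberField E) (_ : IsCMField E) (_ : E →+* (K : Type)) (Φ : CMType E)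
        (ι : 𝓞 E →+* End B) (θ : E →+* Module.End ℂ (complexBetti B.X 1)),
        IsCMTypeRealisation Φ B ι θ) P)
    (hA : AVDominatedBy A P) : HodgeConjectureFor A.dim A.X := by
  obtain ⟨n, Θ, h⟩ := exists_avDominatedBy_cmProdAV_of_isProductOf_realisations h₃
    (thm3_isogenousPower_of_riemann hR h₃) (thm2_cor_of_riemann hR) hP
  exact hodgeConjectureFor_of_avDominatedBy_cmProdAV_of_weilFaceAlgebraic_of_riemann hHD hI hU h₃ K hR hG h6
    hfaces A (hA.trans h)

/-- **Isogeny form** (universe shape): every abelian variety isogenous to such a product `P` — and `P` itself —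
satisfies the Hodge conjecture, modulo `hR` and the model data. [cite: MumfordAV1970, §19]
[cite: Milne2020HodgeClassesAV, Theorem 1] -/
theorem hodgeConjectureFor_of_isIsogenous_isProductOf_of_weilFaceAlgebraic_of_riemann
    (hHD : exists_isReal_hodgeModel) (hI : hodgePQ_independent_of_hodgeModel)
    (hU : BallQuotientUniformisedDatum) (h₃ : CMAbelianVarietyRealised) (K : CMField)
    (hR : DeligneMilne1982_Thm_6_20_full) (hG : IsGalois ℚ K) (h6 : 6 ≤ Module.finrank ℚ K)
    (hfaces : ∀ f : Face K, (universeOf hHD hI hU h₃).WeilFaceAlgebraic K f)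
    {P A : AbelianVariety ℂ} (hP : AbelianVariety.IsProductOf (fun B : AbelianVariety ℂ =>
      ∃ (E : Type) (_ : Field E) (_ : NumberField E) (_ : IsCMField E) (_ : E →+* (K : Type)) (Φ : CMType E)
        (ι : 𝓞 E →+* End B) (θ : E →+* Module.End ℂ (complexBetti B.X 1)),
        IsCMTypeRealisation Φ B ι θ) P)
    (hA : AbelianVariety.IsIsogenous A P) : HodgeConjectureFor A.dim A.X :=
  hodgeConjectureFor_of_avDominatedBy_isProductOf_of_weilFaceAlgebraic_of_riemann hHD hI hU h₃ K hR hG h6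
    hfaces hP (AVDominatedBy.of_isIsogenous hA (AVDominatedBy.refl P))

/-- **Headline instance `B^{a+1} × E^{b+1}`** (universe shape): for a realisation `(B, ι_B, θ_B)` of a CM type
`Ψ` of `F` and a realisation `(E, ι_E, θ_E)` of a CM type `Φ₀` of a CM field `E₀` with `k : E₀ →+* F`
(e.g. a CM elliptic curve of an imaginary quadratic subfield of `F`), every abelian variety dominated by
`B^{a+1} × E^{b+1}` satisfies the Hodge conjecture — given the face lines of `F`, modulo `hR` and the model
data. [cite: Shimura1998, §6.2 Theorem 3 and §6.1 Corollary of Theorem 2 (pp. 41–43)]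
[cite: Milne2020HodgeClassesAV, Theorem 1] -/
theorem hodgeConjectureFor_of_avDominatedBy_powSucc_prod_powSucc_of_weilFaceAlgebraic_of_riemann
    (hHD : exists_isReal_hodgeModel) (hI : hodgePQ_independent_of_hodgeModel)
    (hU : BallQuotientUniformisedDatum) (h₃ : CMAbelianVarietyRealised) (K : CMField)
    (hR : DeligneMilne1982_Thm_6_20_full) (hG : IsGalois ℚ K) (h6 : 6 ≤ Module.finrank ℚ K)
    (hfaces : ∀ f : Face K, (universeOf hHD hI hU h₃).WeilFaceAlgebraic K f)
    {Ψ : CMType K} {B : AbelianVariety ℂ} {ιB : 𝓞 K →+* End B}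
    {θB : (K : Type) →+* Module.End ℂ (complexBetti B.X 1)} (hB : IsCMTypeRealisation Ψ B ιB θB)
    {E₀ : Type} [Field E₀] [NumberField E₀] [IsCMField E₀] (k : E₀ →+* (K : Type)) {Φ₀ : CMType E₀}
    {E : AbelianVariety ℂ} {ιE : 𝓞 E₀ →+* End E} {θE : E₀ →+* Module.End ℂ (complexBetti E.X 1)}
    (hE : IsCMTypeRealisation Φ₀ E ιE θE) (a b : ℕ) {A : AbelianVariety ℂ}
    (hA : AVDominatedBy A ((B.powSucc a).prod (E.powSucc b))) : HodgeConjectureFor A.dim A.X :=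
  hodgeConjectureFor_of_avDominatedBy_isProductOf_of_weilFaceAlgebraic_of_riemann hHD hI hU h₃ K hR hG h6 hfaces
    (isProductOf_powSucc_prod_powSucc (Q := fun B : AbelianVariety ℂ =>
      ∃ (E : Type) (_ : Field E) (_ : NumberField E) (_ : IsCMField E) (_ : E →+* (K : Type)) (Φ : CMType E)
        (ι : 𝓞 E →+* End B) (θ : E →+* Module.End ℂ (complexBetti B.X 1)), IsCMTypeRealisation Φ B ι θ)
      ⟨K, inferInstance, inferInstance, inferInstance, RingHom.id _, Ψ, ιB, θB, hB⟩
      ⟨E₀, inferInstance, inferInstance, inferInstance, k, Φ₀, ιE, θE, hE⟩ a b) hA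

/-- **The `F`-generated CM slice from André's binder shape** (`hW`: for every face `f` of `F` the rational
`(2,2)` `K`-Weil-line classes of the four corner realisations are algebraic — the `p = 2`, untwisted-corner
instance of the binder of `AndreProductForm.mem_algebraicClasses_cmTypedProduct`): HC for every abelian variety
dominated by a finite product of realisations of CM types of CM fields embeddable in `F`
(b07's `hodgeConjectureFor_of_avDominatedBy_cmProdAV_of_weilLineClasses_of_riemann` ∘ §1).  Modulo `hR`; the
model data `hHD hI hU` enter only the proof.
[cite: Andre1992HodgeCM, Théorème (pp. 4–5)] [cite: Milne2020HodgeClassesAV, Theorem 1]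
[cite: MumfordAV1970, §19] -/
theorem hodgeConjectureFor_of_avDominatedBy_isProductOf_of_weilLineClasses_of_riemann
    (hHD : exists_isReal_hodgeModel) (hI : hodgePQ_independent_of_hodgeModel)
    (hU : BallQuotientUniformisedDatum) (h₃ : CMAbelianVarietyRealised) (K : CMField)
    (hR : DeligneMilne1982_Thm_6_20_full) (hG : IsGalois ℚ K) (h6 : 6 ≤ Module.finrank ℚ K)
    (hW : ∀ (f : Face K) (t : complexBetti (⨁ cornerAV h₃ K f.corner).X (2 * 2)), IsRationalClass t →
      IsOfHodgeType (⨁ cornerAV h₃ K f.corner).dim (⨁ cornerAV h₃ K f.corner).X (2 * 2) 2 2 t →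
      t ∈ weilLineClasses (cornerAV h₃ K f.corner) (cornerAct h₃ K f.corner) (2 * 2) →
      t ∈ algebraicClasses (⨁ cornerAV h₃ K f.corner).X 2)
    {P A : AbelianVariety ℂ} (hP : AbelianVariety.IsProductOf (fun B : AbelianVariety ℂ =>
      ∃ (E : Type) (_ : Field E) (_ : NumberField E) (_ : IsCMField E) (_ : E →+* (K : Type)) (Φ : CMType E)
        (ι : 𝓞 E →+* End B) (θ : E →+* Module.End ℂ (complexBetti B.X 1)),
        IsCMTypeRealisation Φ B ι θ) P)
    (hA : AVDominatedBy A P) : HodgeConjectureFor A.dim A.X := by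
  obtain ⟨n, Θ, h⟩ := exists_avDominatedBy_cmProdAV_of_isProductOf_realisations h₃
    (thm3_isogenousPower_of_riemann hR h₃) (thm2_cor_of_riemann hR) hP
  exact hodgeConjectureFor_of_avDominatedBy_cmProdAV_of_weilLineClasses_of_riemann hHD hI hU h₃ K hR hG h6 hW
    A (hA.trans h)

end Summit.HodgeConjecture.CorCM.Model

/-! ## §3 Closed forms: the model data instantiated by the tree theorems — displayed leaves `{h₁, faces of F}` -/

namespace Summit.HodgeConjecture.CorCM

open Summit.HodgeConjecture.CorCM.Domination Summit.HodgeConjecture.CorCM.Model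

/-- **The `F`-generated CM slice of the Hodge conjecture, CLOSED FORM.**  For every ball-quotient uniformisation
record `h₁` and every Galois CM field `F` with `6 ≤ [F:ℚ]`: if all rank-four face lines of `F` are algebraic on
the model universe of the E term `Model.picardCMUniverse _ _ h₁ cmAbelianVarietyRealised_holds` (the universe of
`hc_cm_closed`), then every complex abelian variety dominated by a finite product of realisations of CM types
of CM fields embeddable in `F` satisfies the Hodge conjecture in every codimension.  The four model data are the
tree theorems `exists_isReal_hodgeModel_holds`, `hodgePQ_independent_of_hodgeModel_holds`,
`cmAbelianVarietyRealised_holds` (Shimura §6.2 Thm. 3 on the algebraised CM torus) and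
`deligneMilne1982_Thm_6_20_full_holds` (Riemann's theorem); `hU := ballQuotientUniformisedDatum_of h₁`.
[cite: Shimura1998, §6.2 Theorem 3 and §6.1 Corollary of Theorem 2 (pp. 41–43)]
[cite: DeligneMilne1982Tannakian, §6 Thm. 6.20 (Riemann), p. 212] [cite: Milne2020HodgeClassesAV, Theorem 1] -/
theorem hodgeConjectureFor_of_avDominatedBy_isProductOf_of_weilFaceAlgebraic (K : CMField)
    (h₁ : BallQuotientUniformised)
    (hG : IsGalois ℚ K) (h6 : 6 ≤ Module.finrank ℚ K)
    (hfaces : ∀ f : Face K, (Model.picardCMUniverse exists_isReal_hodgeModel_holds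
      hodgePQ_independent_of_hodgeModel_holds h₁ cmAbelianVarietyRealised_holds).WeilFaceAlgebraic K f)
    {P A : AbelianVariety ℂ} (hP : AbelianVariety.IsProductOf (fun B : AbelianVariety ℂ =>
      ∃ (E : Type) (_ : Field E) (_ : NumberField E) (_ : IsCMField E) (_ : E →+* (K : Type)) (Φ : CMType E)
        (ι : 𝓞 E →+* End B) (θ : E →+* Module.End ℂ (complexBetti B.X 1)),
        IsCMTypeRealisation Φ B ι θ) P)
    (hA : AVDominatedBy A P) : HodgeConjectureFor A.dim A.X :=
  hodgeConjectureFor_of_avDominatedBy_isProductOf_of_weilFaceAlgebraic_of_riemann exists_isReal_hodgeModel_holds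
    hodgePQ_independent_of_hodgeModel_holds (ballQuotientUniformisedDatum_of h₁) cmAbelianVarietyRealised_holds K
    deligneMilne1982_Thm_6_20_full_holds hG h6 hfaces hP hA

/-- **Closed form, isogeny reading**: every abelian variety isogenous to such a product satisfies HC, displayed
leaves `{h₁, faces of F}`. [cite: MumfordAV1970, §19] [cite: Milne2020HodgeClassesAV, Theorem 1] -/
theorem hodgeConjectureFor_of_isIsogenous_isProductOf_of_weilFaceAlgebraic (K : CMField)
    (h₁ : BallQuotientUniformised)
    (hG : IsGalois ℚ K) (h6 : 6 ≤ Module.finrank ℚ K)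
    (hfaces : ∀ f : Face K, (Model.picardCMUniverse exists_isReal_hodgeModel_holds
      hodgePQ_independent_of_hodgeModel_holds h₁ cmAbelianVarietyRealised_holds).WeilFaceAlgebraic K f)
    {P A : AbelianVariety ℂ} (hP : AbelianVariety.IsProductOf (fun B : AbelianVariety ℂ =>
      ∃ (E : Type) (_ : Field E) (_ : NumberField E) (_ : IsCMField E) (_ : E →+* (K : Type)) (Φ : CMType E)
        (ι : 𝓞 E →+* End B) (θ : E →+* Module.End ℂ (complexBetti B.X 1)),
        IsCMTypeRealisation Φ B ι θ) P)
    (hA : AbelianVariety.IsIsogenous A P) : HodgeConjectureFor A.dim A.X :=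
  hodgeConjectureFor_of_avDominatedBy_isProductOf_of_weilFaceAlgebraic K h₁ hG h6 hfaces hP
    (AVDominatedBy.of_isIsogenous hA (AVDominatedBy.refl P))

/-- **Closed form, headline `B^{a+1} × E^{b+1}`**: `B` realising a CM type of `F`, `E` realising a CM type of a
CM field `E₀` with `k : E₀ →+* F`; every abelian variety dominated by `B^{a+1} × E^{b+1}` satisfies HC —
displayed leaves `{h₁, faces of F}`.  (For a cyclic sextic `F` and `E₀` its imaginary quadratic subfield these
are the varieties of PORTFOLIO-lit-andre-3 §3.1 CONSEQUENCE 2, which carry exceptional Hodge classes from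
dimension 6 on.)
[cite: Shimura1998, §6.2 Theorem 3 and §6.1 Corollary of Theorem 2 (pp. 41–43)]
[cite: Milne2020HodgeClassesAV, Theorem 1] -/
theorem hodgeConjectureFor_of_avDominatedBy_powSucc_prod_powSucc_of_weilFaceAlgebraic
    (K : CMField) (h₁ : BallQuotientUniformised) (hG : IsGalois ℚ K) (h6 : 6 ≤ Module.finrank ℚ K)
    (hfaces : ∀ f : Face K, (Model.picardCMUniverse exists_isReal_hodgeModel_holds
      hodgePQ_independent_of_hodgeModel_holds h₁ cmAbelianVarietyRealised_holds).WeilFaceAlgebraic K f)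
    {Ψ : CMType K} {B : AbelianVariety ℂ} {ιB : 𝓞 K →+* End B}
    {θB : (K : Type) →+* Module.End ℂ (complexBetti B.X 1)} (hB : IsCMTypeRealisation Ψ B ιB θB)
    {E₀ : Type} [Field E₀] [NumberField E₀] [IsCMField E₀] (k : E₀ →+* (K : Type)) {Φ₀ : CMType E₀}
    {E : AbelianVariety ℂ} {ιE : 𝓞 E₀ →+* End E} {θE : E₀ →+* Module.End ℂ (complexBetti E.X 1)}
    (hE : IsCMTypeRealisation Φ₀ E ιE θE) (a b : ℕ) {A : AbelianVariety ℂ}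
    (hA : AVDominatedBy A ((B.powSucc a).prod (E.powSucc b))) : HodgeConjectureFor A.dim A.X :=
  hodgeConjectureFor_of_avDominatedBy_powSucc_prod_powSucc_of_weilFaceAlgebraic_of_riemann
    exists_isReal_hodgeModel_holds hodgePQ_independent_of_hodgeModel_holds (ballQuotientUniformisedDatum_of h₁)
    cmAbelianVarietyRealised_holds K deligneMilne1982_Thm_6_20_full_holds hG h6 hfaces hB k hE a b hA

end Summit.HodgeConjecture.CorCM

end
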